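import Literature.Combinatorics.Designs.GoethalsSeidelArray

/-!
# The propus array

[Balonin–Đoković–Karbovskiy, Spec. Matrices 6 (2018) 11–22 = arXiv:1710.03037, eqs. (1)–(2)]
(`BaloninDjokovicKarbovskiy2018`; the array is due to Seberry–Balonin): for circulant matrices `C₁, C₂, C₃, C₄` of
order `v` with `Σ Cᵢ Cᵢᵀ = m·I` and `R` the back-diagonal permutation matrix, the propus array

  `P = [[-C₁,   C₂R,  C₃R,  C₄R ],
        [ C₃R,  RC₄,  C₁,  -RC₂ ],
        [ C₂R,  C₁,  -RC₄,  RC₃ ],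
        [ C₄R, -RC₃,  RC₂,  C₁  ]]`

satisfies `P Pᵀ = m·I` (`propusMatrix_mul_transpose`); with `±1` first rows whose periodic autocorrelations sum to `0`
off zero it is a Hadamard matrix of order `4v` (`propus_isHadamard`), and if moreover `C₁` is symmetric and `C₂ = C₃`
("propus difference family") the matrix is SYMMETRIC (`propusMatrix_transpose_of_symm`) — the source of the known
symmetric Hadamard matrices of orders `4v` for many odd `v` and the census sub-family F6 at `v = 167`.
As in `GoethalsSeidelArray`, `X R = bcirc x` and `R X = bcircT x` (entries `x (i + j)` and `x (-(i + j))`), so `R`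
never appears.  Our formalisation of the published construction; no `sorry`, no new axioms.
-/

open Matrix BigOperators Finset

namespace Literature.Combinatorics.Designs.Propus

open Literature.Combinatorics.Designs.LegendrePairs (PAF IsPM)
open Literature.Combinatorics.Designs.GoethalsSeidel (IsHadamardMatrix gram_of_paf circT bcirc bcircT
  bcirc_apply bcircT_apply transpose_bcirc transpose_bcircT bcirc_mul_bcirc bcirc_mul_bcircT bcircT_mul_bcirc
  bcircT_mul_bcircT bcirc_mul_circT bcircT_mul_circT circT_mul_circulant transpose_circT)

section General

variable {G : Type*} [AddCommGroup G] [Fintype G] [DecidableEq G] {α : Type*} [CommRing α]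

omit [DecidableEq G] in
/-- circulants commute (Mathlib); instance form used to orient products below. [folklore] -/
private lemma cc (x y : G → α) : circulant x * circulant y = circulant y * circulant x := circulant_mul_comm x y

omit [DecidableEq G] in
/-- transposed circulants commute; instance form used to orient products below. [folklore] -/
private lemma ccT (x y : G → α) : circT x * circT y = circT y * circT x := by
  rw [circT, circT, circulant_mul_comm]

/-- the sixteen blocks of the propus array on first rows `c₁, c₂, c₃, c₄` (`Cᵢ = circulant cᵢ`, `Cᵢ R = bcirc cᵢ`,
`R Cᵢ = bcircT cᵢ`). [cite: BaloninDjokovicKarbovskiy2018, eq. (1)] -/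
def propusBlocks (c₁ c₂ c₃ c₄ : G → α) : Fin 4 → Fin 4 → Matrix G G α :=
  ![![-circulant c₁, bcirc c₂, bcirc c₃, bcirc c₄],
    ![bcirc c₃, bcircT c₄, circulant c₁, -bcircT c₂],
    ![bcirc c₂, circulant c₁, -bcircT c₄, bcircT c₃],
    ![bcirc c₄, -bcircT c₃, bcircT c₂, circulant c₁]]

/-- the propus array as a matrix indexed by `Fin 4 × G`. [cite: BaloninDjokovicKarbovskiy2018, eq. (1)] -/
def propusMatrix (c₁ c₂ c₃ c₄ : G → α) : Matrix (Fin 4 × G) (Fin 4 × G) α :=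
  Matrix.of fun p q => propusBlocks c₁ c₂ c₃ c₄ p.1 q.1 p.2 q.2

omit [DecidableEq G] in
/-- block form of `P Pᵀ`. [folklore] -/
private lemma propusMatrix_mul_transpose_apply (c₁ c₂ c₃ c₄ : G → α) (p r : Fin 4) (i k : G) :
    (propusMatrix c₁ c₂ c₃ c₄ * (propusMatrix c₁ c₂ c₃ c₄)ᵀ) (p, i) (r, k) =
      (∑ q, propusBlocks c₁ c₂ c₃ c₄ p q * (propusBlocks c₁ c₂ c₃ c₄ r q)ᵀ) i k := by
  simp only [propusMatrix, mul_apply, transpose_apply, of_apply, Fintype.sum_prod_type, Matrix.sum_apply]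

omit [DecidableEq G] in
/-- **the propus block identities**: `Σ_q P_{pq} P_{rq}ᵀ = [p = r] · Σ Cᵢ Cᵢᵀ`. [cite: BaloninDjokovicKarbovskiy2018, eq. (2)] -/
theorem propus_block_identity (c₁ c₂ c₃ c₄ : G → α) (p r : Fin 4) :
    ∑ q, propusBlocks c₁ c₂ c₃ c₄ p q * (propusBlocks c₁ c₂ c₃ c₄ r q)ᵀ =
      if p = r then Literature.Combinatorics.Designs.GoethalsSeidel.gram c₁ c₂ c₃ c₄ else 0 := by
  fin_cases p <;> fin_cases r <;>
    simp [propusBlocks, Literature.Combinatorics.Designs.GoethalsSeidel.gram, Fin.sum_univ_four, Matrix.transpose_neg,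
      transpose_bcirc, transpose_bcircT, bcirc_mul_bcirc, bcirc_mul_bcircT, bcircT_mul_bcirc, bcircT_mul_bcircT,
      bcirc_mul_circT, bcircT_mul_circT, circT_mul_circulant,
      cc c₃ c₂, cc c₄ c₂, cc c₄ c₃, ccT c₃ c₂, ccT c₄ c₂, ccT c₄ c₃] <;>
    abel

/-- **Propus array.** If `Σ Cᵢ Cᵢᵀ = m·I` for circulants `C₁..C₄` over a finite abelian group then the propus array
satisfies `P Pᵀ = m·I`. [cite: BaloninDjokovicKarbovskiy2018, eq. (2)] -/
theorem propusMatrix_mul_transpose (c₁ c₂ c₃ c₄ : G → α) (m : α)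
    (h : Literature.Combinatorics.Designs.GoethalsSeidel.gram c₁ c₂ c₃ c₄ = m • (1 : Matrix G G α)) :
    propusMatrix c₁ c₂ c₃ c₄ * (propusMatrix c₁ c₂ c₃ c₄)ᵀ = m • (1 : Matrix (Fin 4 × G) (Fin 4 × G) α) := by
  ext ⟨p, i⟩ ⟨r, k⟩
  rw [propusMatrix_mul_transpose_apply, propus_block_identity]
  by_cases hpr : p = r
  · subst hpr
    simp [h, Matrix.one_apply]
  · have : (p, i) ≠ (r, k) := fun e => hpr (Prod.mk.inj e).1
    simp [hpr, this]

omit [Fintype G] [DecidableEq G] in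
/-- **Symmetry of the propus array**: if `C₁` is symmetric (`c₁ (-i) = c₁ i`) and `C₂ = C₃` then `Pᵀ = P`.
[cite: BaloninDjokovicKarbovskiy2018, eq. (2) (symmetry conditions)] -/
theorem propusMatrix_transpose_of_symm (c₁ c₂ c₄ : G → α) (h₁ : ∀ i, c₁ (-i) = c₁ i) :
    (propusMatrix c₁ c₂ c₂ c₄)ᵀ = propusMatrix c₁ c₂ c₂ c₄ := by
  have hC : (circulant c₁)ᵀ = circulant c₁ := by
    rw [transpose_circulant]; exact congrArg circulant (funext h₁)
  have hb : ∀ p q : Fin 4, (propusBlocks c₁ c₂ c₂ c₄ q p)ᵀ = propusBlocks c₁ c₂ c₂ c₄ p q := by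
    intro p q
    fin_cases p <;> fin_cases q <;>
      simp [propusBlocks, Matrix.transpose_neg, transpose_bcirc, transpose_bcircT, hC]
  ext ⟨p, i⟩ ⟨q, j⟩
  have h := congrFun (congrFun (hb p q) i) j
  simp only [transpose_apply] at h
  simp only [propusMatrix, transpose_apply, of_apply]
  exact h

end General

/-! ## First rows: the Hadamard conclusion -/

section Sequences

variable {n : ℕ} [NeZero n]

omit [NeZero n] in
/-- the entries of the propus array are `±1` when the first rows are. [cite: BaloninDjokovicKarbovskiy2018, eq. (1)] -/
lemma propusMatrix_pm (c₁ c₂ c₃ c₄ : ZMod n → ℤ) (h₁ : IsPM c₁) (h₂ : IsPM c₂) (h₃ : IsPM c₃) (h₄ : IsPM c₄)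
    (P Q : Fin 4 × ZMod n) : propusMatrix c₁ c₂ c₃ c₄ P Q = 1 ∨ propusMatrix c₁ c₂ c₃ c₄ P Q = -1 := by
  have hneg : ∀ x : ZMod n → ℤ, IsPM x → ∀ t, -x t = 1 ∨ -x t = -1 := fun x hx t => by
    rcases hx t with h | h
    · right; rw [h]
    · left; rw [h]; norm_num
  obtain ⟨p, i⟩ := P
  obtain ⟨q, j⟩ := Q
  simp only [propusMatrix, of_apply]
  fin_cases p <;> fin_cases q <;>
    simp only [propusBlocks, Fin.zero_eta, Fin.mk_one, Fin.isValue, Matrix.cons_val_zero, Matrix.cons_val_one,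
      Matrix.neg_apply, bcirc_apply, bcircT_apply, circulant_apply] <;>
    first
      | exact h₁ _ | exact h₂ _ | exact h₃ _ | exact h₄ _
      | exact hneg c₁ h₁ _ | exact hneg c₂ h₂ _ | exact hneg c₃ h₃ _ | exact hneg c₄ h₄ _

/-- **Propus Hadamard matrices.** Four `±1` sequences `c₁..c₄` on `ZMod n` with autocorrelations summing to `0` at
every non-zero shift give, through the propus array, a Hadamard matrix of order `4n`; by
`propusMatrix_transpose_of_symm` it is symmetric when `c₁` is symmetric and `c₂ = c₃`.
[cite: BaloninDjokovicKarbovskiy2018, eq. (2)] -/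
theorem propus_isHadamard (c₁ c₂ c₃ c₄ : ZMod n → ℤ) (h₁ : IsPM c₁) (h₂ : IsPM c₂) (h₃ : IsPM c₃) (h₄ : IsPM c₄)
    (hs : ∀ s : ZMod n, s ≠ 0 → PAF c₁ s + PAF c₂ s + PAF c₃ s + PAF c₄ s = 0) :
    IsHadamardMatrix (propusMatrix c₁ c₂ c₃ c₄) := by
  refine ⟨propusMatrix_pm c₁ c₂ c₃ c₄ h₁ h₂ h₃ h₄, ?_⟩
  have hcard : (Fintype.card (Fin 4 × ZMod n) : ℤ) = 4 * n := by simp [Fintype.card_prod, ZMod.card]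
  rw [hcard]
  exact propusMatrix_mul_transpose c₁ c₂ c₃ c₄ _ (gram_of_paf c₁ c₂ c₃ c₄ h₁ h₂ h₃ h₄ hs)

end Sequences

end Literature.Combinatorics.Designs.Propus
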